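import Mathlib.GroupTheory.SpecificGroups.Cyclic
import Mathlib.Data.ZMod.QuotientGroup
import Mathlib.Data.ENat.Lattice
import HarnessLib

/-!
# T1 JET (cell `bsd-jet`), road K: Jetchev 2008 §6 — Thm. 6.3 and the proof of Thm. 1.4 — as
# KERNEL theorems over ABSTRACT Selmer-module data (the carrier-blind half of the (J∥) discharge)

HONEST FRAMING (programme file `BSD-LIT2PART-PROGRAMME-v1.md` §HONESTY, verbatim): «no tranche here
proves BSD; ARM L moves the LITERAL column of an r ≤ 1 census into the kernel-proved-modulo-named-print
column; ARM P changes what «named print» is worth.» THEOREMS ONLY (seat `bsd-jet-pv-2`, session g2;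
`--supports stmt-BirchSwinnertonDyer-14418`, helper). Nothing is booked; no flag is struck by this
file; 0 classes move. What it does: the register flag `JET@p∣N` (237 143 classes) is the use of
D. Jetchev, *Global divisibility of Heegner points and Tamagawa numbers*, Compos. Math. **144** (2008)
811–826 [held: `paper:arxiv-math_0703431`], Thm. 1.4 (`m_∞ ≥ m_max`) at a prime `p ∣ N`, outside
the printed Hypothesis (∗) ∋ «`p ∤ N`». The cell's READING (sheets `HOME/sheets/PV1-A-BLOCK-READING.md`
279217d9, `PV2-B-GAP.md` 38c31e42; kernel binders `JET.JetchevDivisibilityCarrierNe` ∕ `…CarrierMult`,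
`Rank1ResidualJetDefs.lean`) is that «`p ∤ N`» enters the printed proof at exactly ONE line — Lemma 4.3
inside Prop. 4.9 at the places over the Tamagawa carrier `q` — and that §§5–6 (Poitou–Tate, the
lozenge Lemma 5.2, the Čebotarev Lemma 6.1, Thm. 6.3, Prop. 6.4 and the final deduction) are
CARRIER-BLIND bookkeeping with finite `ℤ/p^m`-modules. This file turns the second half of that
sentence into kernel statements: Thm. 6.3 (p. 823, proof pp. 823–824) and the «Proof of Theorem 1.4»
paragraph (p. 825) are PROVED here over abstract data — finite abelian groups, subgroups, localisation
homomorphisms and orders of elements — whose hypotheses are, one for one, the OUTPUTS of the printed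
inputs (Thm. 5.1 at `q` and at `λ`, (δ) the local quotient at `q`, Lemma 6.1, Prop. 4.7, Prop. 4.9,
§3.1 item 7, Prop. 6.4, and Kolyvagin's redefinition of `m_∞` = McCallum 1991 Prop. 5.2) and contain
NO datum about the reduction of `E` at `p`, the residue characteristic of the carrier, or `N`.
Consequently, once those inputs are supplied at a pair `(E, p)` — for the carrier `q ≠ p` every one of
them is print without a `p`-versus-`N` clause (sheet PV1-A §2), for `q = p` multiplicative the single
input Prop. 4.9 at `v ∣ p` is the x11b3 tree theorem
`X11b.Three.JetchevKummer.localKummerMap_mem_connectedKummerCondition_padic_of_cocycle` (sheet PV2-B §2)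
— the conclusion `m_∞ ≥ ord_p c_q` follows by THESE theorems, not by a reading of §6. The instantiation
layer (concrete Selmer structures `𝓕(c)`, `𝓕_⌈q⌉(c)`, `(𝓕₀)^ℓ(c)` on `H¹(K, E[p^m])^±` and the named
facts feeding the hypotheses below) is NOT in the tree and is NOT attempted here (sheet
`HOME/sheets/PV2-J6-KERNEL.md` lists it as the stub set of the (J∥) kernel line); so nothing here is
yet CONSUMED by a row binder — these are helper theorems recorded against item 14418, like the x11b3
S15 layer theorems they are meant to meet.

## Dictionary (abstract symbol ↦ printed object, [J] = Jetchev 2008, locators = held text page:line)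

Fix `m`, a conductor `c ∈ Λ_m`, the sign `ε = ε(c)`, the carrier prime `q ∣ N` with `t := ord_p c_q`
(the paper's `m_max`; Thm. 6.3's proof uses of `q` only «`p^{m_max} ∣ c_v`», p0015:L80–82, so any
single `q` with `t = ord_p c_q` does), `𝓕` the Kummer Selmer structure, `𝓕₀ := 𝓕_⌈q⌉` (Def. 4.8).
* `Hp`, `Hm` ↦ `H¹(K, E[p^m])^{ε}`, `H¹(K, E[p^m])^{−ε}`; `ι` ↦ the Kolyvagin primes `ℓ ∈ Λ¹_m`, `ℓ ∤ c`;
  `Lp ℓ`, `Lm ℓ` ↦ `H¹(K_λ, E[p^m])^{±}` (`λ` the prime of `K` over `ℓ`), `locP ℓ`, `locM ℓ` ↦ `loc_λ`.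
* `A' ↦ 𝓗_{𝓕(c)}^{−ε}`, `B' ↦ 𝓗_{𝓕₀(c)}^{−ε}`, `C' ↦ 𝓗_{𝓕₀(c)^*}^{−ε}`, `D' ℓ ↦ 𝓗_{(𝓕₀)^ℓ(c)}^{−ε}`
  (= `𝓗_{(𝓕₀)^ℓ(cℓ)}^{−ε}`, p0015:L104), all inside `Hm`; `hB'A'` ↦ `𝓕₀ ≼ 𝓕`.
* `hcore : A' = ⊥` ↦ «`c` is a core vertex and `κ_{c,m} ≠ 0` lies on the `ε` side, so
  `𝓗_{𝓕(c)}^{−ε(c)} = 0`» (p0015:L38–48, L56–57).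
* `Q`, `Q'`, `locq`, `locq'`, `hker`, `horth_q` ↦ Thm. 5.1 (p0014:L16–41) applied to `𝓕₀(c) ≼ 𝓕(c)`,
  `−ε` parts: the two exact sequences of p0015:L70–79 with local terms `Q = (H¹_Kum/H¹_{Kum⁰})^{−ε}`,
  `Q' = ((H¹_{Kum⁰})^⊥/H¹_Kum)^{−ε}` at `v, v̄ ∣ q`, and «the images are exact orthogonal complements»
  under the (perfect) Tate pairing, whence `#im(loc) · #im(loc^*) = #Q = #Q'`;
  `hQ'cyc`, `hQ'card` ↦ (δ) «both of the local quotients … are isomorphic to `ℤ/p^{m_max}`» (p0015:L80–82;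
  cyclicity = the `p`-part of `Φ_q(𝔽_q)` is cyclic — split `I_n`, or IV/IV* at `p = 3`).
* `h61` ↦ Lemma 6.1 (p0015:L10–25; = McCallum 1991 Cor. 3.2, Čebotarev; `ℓ` may be taken prime to `c`).
* `S ℓ`, `sing ℓ`, `hsing`, `horth_ℓ` ↦ Thm. 5.1 ∕ Lemma 5.2 (iii) (p0014:L43 – p0015:L8) for
  `𝓕₀(c) ≼ (𝓕₀)^ℓ(c)`, `−ε` parts: `S ℓ = (H¹(K_λ)/H¹_ur(K_λ))^{−ε} ≅ ℤ/p^m`, dual local term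
  `H¹_ur(K_λ)^{−ε} ≅ ℤ/p^m` receiving `loc_λ` on `𝓗_{𝓕₀(c)^*}` (whose kernel is `𝓗_{(𝓕₀^*)_ℓ(c)}`),
  images orthogonal complements: `[𝓗_{(𝓕₀)^ℓ(c)} : 𝓗_{𝓕₀(c)}] · #loc_λ(𝓗_{𝓕₀(c)^*}) = p^m`
  (the third lozenge of p0016:L12–17 read with Lemma 5.2 (iii)).
* `κt`, `κ`, `hκ`, `hκt` ↦ `κ̃_{c,m}`, `κ_{c,m} = p^{m(c)} κ̃_{c,m}`, `ord κ̃_{c,m} = m` (§3.1 item 7,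
  p0008:L7–36) with `m(c) = m_∞` (minimal core vertex, p0015:L50).
* `κℓ ℓ`, `h49` ↦ `κ_{cℓ,m} ∈ 𝓗_{𝓕₀(cℓ)}^{ε(cℓ)} ⊆ 𝓗_{(𝓕₀)^ℓ(cℓ)}^{−ε(c)}` (Prop. 4.9, p0012:L87 –
  p0013:L45, for the conductor `cℓ`; `ε(cℓ) = −ε(c)`, §3.1 item 6; transverse ≤ no condition at `λ`).
* `h47` ↦ Prop. 4.7 (p0011:L80 – p0012:L28): `loc_λ κ_{cℓ,m} = φ_λ(loc_λ κ_{c,m})` with `φ_λ` an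
  isomorphism, hence equal orders.
* Thm. B/C: `Λ` ↦ Kolyvagin conductors; `M c` ↦ `M(c)` (`⊤` at `c = 1`); `mdiv c` ↦ `m'(c)` = the
  largest `k` with `P_c ∈ p^k E(K[c])` (`⊤` if none); `m c` ↦ `m(c)` (§3.1 item 5, p0007:L77–86);
  `mInf` ↦ `m_∞ = lim m_r = inf_c m(c)` (the `m_r` are non-increasing); `Core k c` ↦ «`c` is a core vertex
  for `k`»; `hK` ↦ «`m_∞ = lim_r inf_{c ∈ Λ^r_{m'}} m(c)` for every large `m'`» (p0017:L8–14, citing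
  [Kolyvagin 1991] = McCallum 1991 Prop. 5.2: for `M > M_r` some `n ∈ S_r(M)` has `ord_p P_n = M_r`);
  `h64` ↦ Prop. 6.4 (p0016:L35–37); `h63` ↦ Thm. 6.3 in the shape proved here.

What is deliberately NOT here: the `ε`-side invariants `Inv 𝓗_{𝓕₀(c)^*}^{ε} = (m, m_max + m′ − m)`
(p0015:L84–90; computed in print but not used by the inequality), Prop. 6.4's own proof (the
invariant-lowering induction, p0016:L38 – p0017:L3 — an INPUT here), Lemma 5.2 (i)(ii)(iv), any
Galois cohomology. References (locators only, no cited FACT is declared): [cite: Jetchev2008, §3.1,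
Prop. 4.7, Prop. 4.9, Thm. 5.1, Lemma 5.2, Lemma 6.1, §6.2 Thm. 6.3, §6.3 Prop. 6.4 and Proof of
Thm. 1.4 (pp. 816–825)] [cite: McCallumLMS1991, §3 Cor. 3.2, §5 Lemma 5.1, Prop. 5.2 (pp. 298–304)].

Design: no definitions; `Type*`-polymorphic abstract data; `Nat.card` throughout; ENat (`ℕ∞`) for
`M(c)`, `m'(c)`, `m(c)`. Axioms: `propext`, `Classical.choice`, `Quot.sound`.
-/

set_option autoImplicit false

noncomputable section

open scoped Classical

namespace Summit.BirchSwinnertonDyer.Rank1Residual.JET.Section6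

/-! ### Two elementary order computations -/

/-- In an additive commutative group, if `y` has order `p^m` and `a ≤ m` then `p^a • y` has order
`p^(m − a)` (used for `κ_{c,m} = p^{m(c)} κ̃_{c,m}` and its localisations). Elementary. -/
theorem addOrderOf_pow_nsmul_eq {G : Type*} [AddCommGroup G] {p : ℕ} (hp : p.Prime) {m a : ℕ}
    (ha : a ≤ m) (y : G) (hy : addOrderOf y = p ^ m) :
    addOrderOf (p ^ a • y) = p ^ (m - a) := by
  have hpa : p ^ a ≠ 0 := pow_ne_zero _ hp.ne_zero
  rw [addOrderOf_nsmul_of_dvd hpa (hy ▸ pow_dvd_pow p ha), hy, Nat.pow_div ha hp.pos]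

/-- An element of a finite subgroup of order `p^k` has order dividing `p^k`; combined with a
homomorphism not increasing orders: if `x ∈ D` with `Nat.card D = n` then `addOrderOf (f x) ∣ n`. -/
theorem addOrderOf_map_dvd_card_of_mem {G L : Type*} [AddCommGroup G] [AddCommGroup L]
    (f : G →+ L) (D : AddSubgroup G) {x : G} (hx : x ∈ D) :
    addOrderOf (f x) ∣ Nat.card D :=
  (addOrderOf_map_dvd f x).trans (D.addOrderOf_dvd_natCard hx)

/-! ### [J] §6.2, Theorem 6.3 — abstract, the `−ε(c)` computation that carries the inequality -/

/-- **Jetchev 2008, Thm. 6.3 (p. 823), abstract kernel form: a minimal core vertex forces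
`ord_p c_q ≤ m_∞`.** Data and hypotheses are the dictionary of the module docstring: inside the
`−ε(c)`-part `Hm` of `H¹(K, E[p^m])` the Selmer modules `A' = 𝓗_{𝓕(c)}` (trivial: `c` is a core
vertex with `κ_{c,m} ≠ 0` on the `ε` side), `B' = 𝓗_{𝓕₀(c)} ≤ A'`, `C' = 𝓗_{𝓕₀(c)^*}`,
`D' ℓ = 𝓗_{(𝓕₀)^ℓ(c)}`; global duality at the carrier (`locq`, `locq'` with `ker locq' = A'` and
`#im locq · #im locq' = #Q'`, Thm. 5.1) with the dual local quotient `Q'` cyclic of order `p^t`,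
`t = ord_p c_q` ((δ), p. 823: «both of the local quotients … are isomorphic to `ℤ/p^{m_max}ℤ`»); the
Čebotarev choice `h61` (Lemma 6.1); duality at `λ` (`sing ℓ` with kernel `B'`,
`#im(sing ℓ) · #loc_λ(C') = p^m`, Lemma 5.2 (iii)); the classes `κ̃_{c,m}` of order `p^m`,
`κ_{c,m} = p^{m_∞} κ̃_{c,m}` (`m(c) = m_∞ ≤ m`), `κ_{cℓ,m} ∈ D' ℓ` (Prop. 4.9) and
`ord loc_λ κ_{cℓ,m} = ord loc_λ κ_{c,m}` (Prop. 4.7). CONCLUSION: `t ≤ m_∞`. PROOF (the printed one,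
pp. 823–824, `−ε` side): `A' = 0` makes `locq'` injective with image of full size, so `C' ≅ Q'` is
cyclic of order `p^t`, generated by some `κ'`; Lemma 6.1 gives `ℓ` with `ord loc_λ κ̃ = m`,
`ord loc_λ κ' = t`; then `#loc_λ(C') = p^t`, so `#D' ℓ = p^{m−t}` (`B' = 0`); `κ_{cℓ,m} ∈ D' ℓ` has
order `∣ p^{m−t}`, hence so does `loc_λ κ_{cℓ,m}`, whose order equals
`ord loc_λ κ_{c,m} = ord (p^{m_∞} loc_λ κ̃) = p^{m − m_∞}`; so `m − m_∞ ≤ m − t`. No datum about the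
reduction of `E` at `p`, about `q` versus `p`, or about `N` occurs.
[cite: Jetchev2008, Thm. 6.3 and its proof (pp. 823–824); Thm. 5.1, Lemma 5.2 (iii), Lemma 6.1, Prop. 4.7, Prop. 4.9] -/
theorem tamagawaExponent_le_mInfty_of_minimalCoreVertex
    {p : ℕ} (hp : p.Prime) {m t mInf : ℕ} (htm : t ≤ m) (hInfm : mInf ≤ m)
    -- global cohomology `H¹(K, E[p^m])^{ε(c)}`, `H¹(K, E[p^m])^{−ε(c)}`; Kolyvagin primes `ℓ ∈ Λ¹_m`, `ℓ ∤ c`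
    {Hp Hm : Type*} [AddCommGroup Hp] [AddCommGroup Hm] {ι : Type*}
    -- local cohomology at `λ ∣ ℓ`, `±` parts, with `loc_λ`
    {Lp Lm : ι → Type*} [∀ ℓ, AddCommGroup (Lp ℓ)] [∀ ℓ, AddCommGroup (Lm ℓ)]
    (locP : ∀ ℓ, Hp →+ Lp ℓ) (locM : ∀ ℓ, Hm →+ Lm ℓ)
    -- the `−ε(c)` Selmer modules
    (A' B' C' : AddSubgroup Hm) (D' : ι → AddSubgroup Hm)
    (hB'A' : B' ≤ A') (hcore : A' = ⊥)
    -- Thm. 5.1 at the carrier `q` for `𝓕₀(c) ≼ 𝓕(c)`, `−ε` parts, and (δ)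
    {Q Q' : Type*} [AddCommGroup Q] [AddCommGroup Q'] [Finite Q']
    (locq : A' →+ Q) (locq' : C' →+ Q')
    (hker : ∀ x : C', locq' x = 0 ↔ (x : Hm) ∈ A')
    (horth_q : Nat.card locq.range * Nat.card locq'.range = Nat.card Q')
    (hQ'cyc : IsAddCyclic Q') (hQ'card : Nat.card Q' = p ^ t)
    -- Lemma 6.1 (Čebotarev)
    (h61 : ∀ (x : Hp) (y : Hm), y ≠ 0 →
      ∃ ℓ, addOrderOf (locP ℓ x) = addOrderOf x ∧ addOrderOf (locM ℓ y) = addOrderOf y)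
    -- Thm. 5.1 / Lemma 5.2 (iii) at `λ` for `𝓕₀(c) ≼ (𝓕₀)^ℓ(c)`, `−ε` parts
    {S : ι → Type*} [∀ ℓ, AddCommGroup (S ℓ)] (sing : ∀ ℓ, D' ℓ →+ S ℓ)
    (hsing : ∀ ℓ (x : D' ℓ), sing ℓ x = 0 ↔ (x : Hm) ∈ B')
    (horth_ℓ : ∀ ℓ, Nat.card (sing ℓ).range * Nat.card (C'.map (locM ℓ)) = p ^ m)
    -- the classes: `κ̃_{c,m}`, `κ_{c,m} = p^{m(c)} κ̃_{c,m}` with `m(c) = m_∞`, `κ_{cℓ,m}`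
    (κt κ : Hp) (hκ : κ = p ^ mInf • κt) (hκt : addOrderOf κt = p ^ m)
    (κℓ : ι → Hm) (h49 : ∀ ℓ, κℓ ℓ ∈ D' ℓ)
    (h47 : ∀ ℓ, addOrderOf (locM ℓ (κℓ ℓ)) = addOrderOf (locP ℓ κ)) :
    t ≤ mInf := by
  -- trivial when `t = 0`
  rcases Nat.eq_zero_or_pos t with ht0 | ht0
  · omega
  -- `B' = 0`
  have hB' : B' = ⊥ := le_bot_iff.mp (hcore ▸ hB'A')
  -- `locq` has trivial image (its source `A'` is trivial), so `#im locq' = #Q' = p^t`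
  have hrange_q : Nat.card locq.range = 1 := by
    have : locq.range = ⊥ := by
      rw [eq_bot_iff]
      rintro _ ⟨x, rfl⟩
      have hx : (x : Hm) ∈ (⊥ : AddSubgroup Hm) := hcore ▸ x.2
      have : x = 0 := by ext; simpa using hx
      simp [this]
    rw [this, AddSubgroup.card_bot]
  rw [hrange_q, one_mul, hQ'card] at horth_q
  -- `locq'` is injective (its kernel is `A' = 0`)
  have hinj : Function.Injective locq' := by
    rw [injective_iff_map_eq_zero]
    intro x hx
    have hx' : (x : Hm) ∈ (⊥ : AddSubgroup Hm) := hcore ▸ (hker x).mp hx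
    ext; simpa using hx'
  -- hence `C'` is cyclic of order `p^t`
  haveI : IsAddCyclic C' := isAddCyclic_of_injective locq' hinj
  have hcardC' : Nat.card C' = p ^ t := by
    rw [← horth_q]; exact Nat.card_congr (AddMonoidHom.ofInjective hinj).toEquiv
  obtain ⟨g, hg⟩ := IsAddCyclic.exists_generator (α := C')
  have hordg : addOrderOf (g : Hm) = p ^ t := by
    rw [AddSubgroup.addOrderOf_coe, addOrderOf_eq_card_of_forall_mem_zmultiples hg, hcardC']
  have hg0 : (g : Hm) ≠ 0 := by
    intro h
    rw [h, addOrderOf_zero] at hordg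
    have : 1 < p ^ t := Nat.one_lt_pow ht0.ne' hp.one_lt
    omega
  -- `C'` is generated by `g` inside `Hm`
  have hC'eq : C' = AddSubgroup.zmultiples (g : Hm) := by
    apply le_antisymm
    · intro x hx
      obtain ⟨k, hk⟩ := AddSubgroup.mem_zmultiples_iff.mp (hg ⟨x, hx⟩)
      exact AddSubgroup.mem_zmultiples_iff.mpr ⟨k, by simpa using congrArg Subtype.val hk⟩
    · exact AddSubgroup.zmultiples_le_of_mem g.2
  -- Lemma 6.1: choose `ℓ`
  obtain ⟨ℓ, hℓP, hℓM⟩ := h61 κt (g : Hm) hg0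
  rw [hκt] at hℓP
  rw [hordg] at hℓM
  -- `#loc_λ(C') = p^t`, so `#D' ℓ = p^(m - t)`
  have hcard_img : Nat.card (C'.map (locM ℓ)) = p ^ t := by
    rw [hC'eq, AddMonoidHom.map_zmultiples, Nat.card_zmultiples, hℓM]
  have hsing_inj : Function.Injective (sing ℓ) := by
    rw [injective_iff_map_eq_zero]
    intro x hx
    have hx' : (x : Hm) ∈ (⊥ : AddSubgroup Hm) := hB' ▸ (hsing ℓ x).mp hx
    ext; simpa using hx'
  have hcardD : Nat.card (D' ℓ) = p ^ (m - t) := by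
    have h1 : Nat.card (D' ℓ) = Nat.card (sing ℓ).range :=
      Nat.card_congr (AddMonoidHom.ofInjective hsing_inj).toEquiv
    have h2 := horth_ℓ ℓ
    rw [hcard_img, ← h1, ← Nat.sub_add_cancel htm, pow_add] at h2
    exact Nat.eq_of_mul_eq_mul_right (pow_pos hp.pos t) h2
  -- the order of `loc_λ κ_{cℓ,m}` divides `p^(m - t)` …
  have hdvd : addOrderOf (locM ℓ (κℓ ℓ)) ∣ p ^ (m - t) :=
    hcardD ▸ addOrderOf_map_dvd_card_of_mem (locM ℓ) (D' ℓ) (h49 ℓ)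
  -- … and equals `ord loc_λ κ_{c,m} = p^(m - mInf)`
  have hordκ : addOrderOf (locP ℓ κ) = p ^ (m - mInf) := by
    rw [hκ, map_nsmul]
    exact addOrderOf_pow_nsmul_eq hp hInfm _ hℓP
  rw [h47 ℓ, hordκ, Nat.pow_dvd_pow_iff_le_right hp.one_lt] at hdvd
  omega

/-! ### [J] §6.3, «Proof of Theorem 1.4» (p. 825) — abstract -/

/-- **Jetchev 2008, proof of Thm. 1.4 (p. 825), abstract kernel form: Prop. 6.4 + Thm. 6.3 +
Kolyvagin's redefinition of `m_∞` give `t ≤ m_∞`.** Data: conductors `Λ` with `M : Λ → ℕ∞`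
(`M(c) = min_{ℓ ∣ c} M(ℓ)`, `⊤` at `c = 1`), `mdiv c = m'(c)` (the exact `p`-divisibility exponent of
`P_c` in `E(K[c])`, `⊤` if `P_c` is infinitely divisible), `m c = m(c)` (= `m'(c)` if `m'(c) ≤ M(c)`,
else `⊤`; §3.1 item 5), `mInf : ℕ` with `mInf ≤ m(c)` for all `c` (it is `inf_c m(c) = lim_r m_r`, the
`m_r` being non-increasing) and ATTAINED at conductors of arbitrarily large `M(c)` (`hK`: Kolyvagin's
redefinition «`m_∞ = lim_r inf_{c ∈ Λ^r_{m'}} m(c)` for every large `m'`», p0017:L8–14 = McCallum 1991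
Prop. 5.2), a predicate `Core k c` («core vertex for `k`»), Prop. 6.4 (`h64`: «Let `c ∈ Λ` satisfy
`m(c) + m ≤ M(c)`. There exists a core vertex `c' ∈ Λ_{m+m(c)}` such that `m(c') ≤ m(c)`») and
Thm. 6.3 in the shape of `tamagawaExponent_le_mInfty_of_minimalCoreVertex` (`h63`: a minimal core
vertex for some `k > max(t, m_∞)` gives `t ≤ m_∞`). CONCLUSION `t ≤ mInf`. PROOF (printed): fix
`k > max{t, m_∞}`; `hK` gives `c` with `m(c) = m_∞` and `M(c) ≥ k + m_∞`; Prop. 6.4 gives a core vertex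
`c'` with `M(c') ≥ k + m_∞` and `m(c') ≤ m_∞`, hence `= m_∞` — a minimal core vertex; Thm. 6.3.
[cite: Jetchev2008, Proof of Thm. 1.4 (p. 825), Prop. 6.4, Thm. 6.3] [cite: McCallumLMS1991, Prop. 5.2 (p. 304)] -/
theorem tamagawaExponent_le_mInfty_of_coreVertices
    {Λ : Type*} (M m : Λ → ℕ∞) (Core : ℕ → Λ → Prop) (t mInf : ℕ)
    (hmInf : ∀ c, (mInf : ℕ∞) ≤ m c)
    (hK : ∀ m' : ℕ, ∃ c, (m' : ℕ∞) ≤ M c ∧ m c = mInf)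
    (h64 : ∀ (k : ℕ) (c : Λ), m c + k ≤ M c →
      ∃ c', Core k c' ∧ (k : ℕ∞) + m c ≤ M c' ∧ m c' ≤ m c)
    (h63 : ∀ (k : ℕ) (c : Λ), Core k c → m c = mInf → (k : ℕ∞) + mInf ≤ M c →
      t < k → mInf < k → t ≤ mInf) :
    t ≤ mInf := by
  set k : ℕ := max t mInf + 1 with hk
  have htk : t < k := by omega
  have hInfk : mInf < k := by omega
  obtain ⟨c, hMc, hmc⟩ := hK (k + mInf)
  have hck : m c + k ≤ M c := by
    rw [hmc]
    calc (mInf : ℕ∞) + k = ((k + mInf : ℕ) : ℕ∞) := by push_cast; ring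
      _ ≤ M c := hMc
  obtain ⟨c', hcore, hMc', hmc'⟩ := h64 k c hck
  rw [hmc] at hMc' hmc'
  exact h63 k c' hcore (le_antisymm hmc' (hmInf c')) hMc' htk hInfk

/-- **From `t ≤ m_∞` to global divisibility to depth `t` (the currency of the tree's binders
`JET.JetchevDivisibilityCarrierNe` ∕ `…CarrierMult` and of McCallum's `M_∞ ≥ t`).** With
`m(c) ≤ m'(c)` whenever `m'(c) < M(c)` (true for [J]'s `m(c) = m'(c)` if `m'(c) ≤ M(c)`, else `⊤`,
§3.1 item 5, AND for McCallum's convention `n ∈ S_r(ord_p P_n + 1)`, §5 p. 303, which requires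
`m'(c) < M(c)` — the two printed conventions differ exactly at `m'(c) = M(c)` and this statement is
insensitive to the difference) and `m_∞ ≤ m(c)` for every `c`: if `t ≤ m_∞` then for every `s ≤ t`
and every conductor `c` with `s ≤ M(c)` (all prime factors Kolyvagin primes of index `≥ s`) one has
`s ≤ m'(c)`, i.e. `P_c ∈ p^s E(K[c])`. PROOF: either `m'(c) < M(c)` and then
`m'(c) ≥ m(c) ≥ m_∞ ≥ t ≥ s`, or `m'(c) ≥ M(c) ≥ s`. [cite: Jetchev2008, §3.1 item 5 (p. 817), Thm. 1.4 (p. 812)] -/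
theorem depth_le_mdiv_of_le_mInfty
    {Λ : Type*} (M mdiv m : Λ → ℕ∞) (hm : ∀ c, mdiv c < M c → m c ≤ mdiv c)
    (mInf : ℕ) (hmInf : ∀ c, (mInf : ℕ∞) ≤ m c) {t : ℕ} (ht : t ≤ mInf)
    (s : ℕ) (hs : s ≤ t) (c : Λ) (hsc : (s : ℕ∞) ≤ M c) :
    (s : ℕ∞) ≤ mdiv c := by
  by_cases h : mdiv c < M c
  · calc (s : ℕ∞) ≤ (t : ℕ∞) := by exact_mod_cast hs
      _ ≤ (mInf : ℕ∞) := by exact_mod_cast ht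
      _ ≤ m c := hmInf c
      _ ≤ mdiv c := hm c h
  · exact hsc.trans (not_lt.mp h)

/-- **[J] Thm. 1.4 for one carrier, abstract END FORM** (composition of the two previous theorems):
under Kolyvagin's redefinition `hK`, Prop. 6.4 `h64` and Thm. 6.3 `h63` (abstract shapes as above),
every derived Heegner point `P_c` whose conductor has all Kolyvagin indices `≥ s`, `s ≤ t = ord_p c_q`,
is `p^s`-divisible: `s ≤ m'(c)`. This is the statement the binders `JET.JetchevDivisibilityCarrierNe`
(`q ≠ p`) and `JET.JetchevDivisibilityCarrierMult` (`q = p`) assert pair by pair, reduced to inputs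
none of which mentions the reduction of `E` at `p`. [cite: Jetchev2008, Thm. 1.4 (p. 812) and its proof (p. 825)] -/
theorem depth_le_mdiv_of_coreVertices
    {Λ : Type*} (M mdiv m : Λ → ℕ∞) (hm : ∀ c, mdiv c < M c → m c ≤ mdiv c)
    (Core : ℕ → Λ → Prop) (t mInf : ℕ) (hmInf : ∀ c, (mInf : ℕ∞) ≤ m c)
    (hK : ∀ m' : ℕ, ∃ c, (m' : ℕ∞) ≤ M c ∧ m c = mInf)
    (h64 : ∀ (k : ℕ) (c : Λ), m c + k ≤ M c →
      ∃ c', Core k c' ∧ (k : ℕ∞) + m c ≤ M c' ∧ m c' ≤ m c)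
    (h63 : ∀ (k : ℕ) (c : Λ), Core k c → m c = mInf → (k : ℕ∞) + mInf ≤ M c →
      t < k → mInf < k → t ≤ mInf)
    (s : ℕ) (hs : s ≤ t) (c : Λ) (hsc : (s : ℕ∞) ≤ M c) :
    (s : ℕ∞) ≤ mdiv c :=
  depth_le_mdiv_of_le_mInfty M mdiv m hm mInf hmInf
    (tamagawaExponent_le_mInfty_of_coreVertices M m Core t mInf hmInf hK h64 h63) s hs c hsc

end Summit.BirchSwinnertonDyer.Rank1Residual.JET.Section6

end
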